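import Literature.AnabelianGeometry.EtaleTheta.FrobenioidCyclotomicRigidity
import HarnessLib

/-!
# [EtTh] Thm 5.7's vocabulary stub `StdThetaPairStub` is a parameter record: inhabited at every `𝔉`, and the typed predicate `ThetaFunctionPreserved` is trivially satisfiable (non-vacuity + calibration)

S. Mochizuki, *The étale theta function and its Frobenioid-theoretic manifestations*, Publ. RIMS **45**
(2009), Thm. 5.7 pp.329–330 (PDF pp.103–104) [cite: MochizukiEtTh2009, Thm 5.7 p.329–330 (PDF pp.103–104)]:
"`Ψ` preserves right fraction-pairs of [… ] an `l`-th root of the theta function … up to possible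
multiplication by a `2l`-th root of unity and possible translation by an element of `ℤ` … or `l·ℤ`".
abc-iut-L2-t4 types the class of such pairs as the ONE-FIELD record
`FrobenioidCyclotomicRigidity.StdThetaPairStub 𝔉` (`IsStdThetaRootFractionPair : (A ⟶ B) → (A ⟶ B) → Prop`,
`TODO-merge(abc-iut-L2-t3, -t2, -t1)`) and Thm. 5.7 over it as `ThetaFunctionPreserved 𝔉 V Ψ`
(`FrobenioidCyclotomicRigidity.lean`).

NV-L2 row `FrobenioidCyclotomicRigidity.StdThetaPairStub` (ZERO producers, census v1/v2b; OPEN in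
abc-iut-w5-d029's triage 05:34Z, class P = parameter record).  PROOF-ONLY (0 definitions):

* `nonempty_stdThetaPairStub` — the record is inhabited at EVERY `𝔉 : ThetaFrobenioid C D` (any relation
  on parallel pairs is an instance; it carries no law);
* CALIBRATION of the typed Thm. 5.7: `thetaFunctionPreserved_of_forall` / `_of_forall_not` / `_of_iff_eq`
  — `ThetaFunctionPreserved 𝔉 V Ψ` HOLDS for EVERY self-equivalence `Ψ` as soon as the stub's class is all
  pairs, no pair, or the diagonal; hence `exists_thetaFunctionPreserved`: as typed, Thm. 5.7 constrains
  `Ψ` exactly as much as the supplied stub does — its content is carried entirely by WHICH class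
  `IsStdThetaRootFractionPair` is plugged in (the genuine one = the `μ_{2l} × (ℤ or l·ℤ)`-orbit of right
  fraction-pairs of standard `l`-th roots of `Θ̈(√−1)⁻¹·Θ̈`, owned by abc-iut-L2-t1/t2/t3 per the
  TODO-merge), never by a ∀/∃-closure over stubs — recorded for the RQ1/RQ7 vacuity audits and for
  consumers of `ThetaFunctionPreserved`.

Post-freeze: new proof-only file, no field added to a frozen structure, no instance, no Prop fact.
[EtTh] is refereed; typed ≠ proved; no side taken on [IUTchIII] Cor. 3.12.
-/

namespace Literature.AnabelianGeometry.EtaleTheta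

namespace FrobenioidCyclotomicRigidity

open CategoryTheory

universe w v v' u u'

variable {C : Type u} [Category.{v} C] {D : Type u'} [Category.{v'} D] (𝔉 : ThetaFrobenioid.{w} C D)

/-- **Non-vacuity of the NV-L2 row `StdThetaPairStub`**: inhabited at every `𝔉` (by the class of ALL
parallel pairs; the record has no law). [cite: MochizukiEtTh2009, Thm 5.7 p.329–330 (PDF pp.103–104)] -/
theorem nonempty_stdThetaPairStub : Nonempty (StdThetaPairStub 𝔉) := ⟨⟨fun _ _ => True⟩⟩

/-- Every relation on parallel pairs is the class of some stub. [cite: MochizukiEtTh2009, Thm 5.7 p.329–330 (PDF pp.103–104)] -/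
theorem exists_stdThetaPairStub_iff (P : ∀ ⦃A B : C⦄, (A ⟶ B) → (A ⟶ B) → Prop) :
    ∃ V : StdThetaPairStub 𝔉, ∀ ⦃A B : C⦄ (s s' : A ⟶ B), V.IsStdThetaRootFractionPair s s' ↔ P s s' :=
  ⟨⟨fun s s' => P s s'⟩, fun _ _ _ _ => Iff.rfl⟩

/-- **Calibration (all pairs)**: if the stub's class is everything, `ThetaFunctionPreserved` holds for
every self-equivalence. [cite: MochizukiEtTh2009, Thm 5.7 p.329–330 (PDF pp.103–104)] -/
theorem thetaFunctionPreserved_of_forall (V : StdThetaPairStub 𝔉)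
    (h : ∀ ⦃A B : C⦄ (s s' : A ⟶ B), V.IsStdThetaRootFractionPair s s') (Ψ : C ≌ C) :
    ThetaFunctionPreserved 𝔉 V Ψ :=
  fun _ _ _ => h _ _

/-- **Calibration (no pair)**: if the stub's class is empty, `ThetaFunctionPreserved` holds for every
self-equivalence (nothing to preserve). [cite: MochizukiEtTh2009, Thm 5.7 p.329–330 (PDF pp.103–104)] -/
theorem thetaFunctionPreserved_of_forall_not (V : StdThetaPairStub 𝔉)
    (h : ∀ ⦃A B : C⦄ (s s' : A ⟶ B), ¬ V.IsStdThetaRootFractionPair s s') (Ψ : C ≌ C) :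
    ThetaFunctionPreserved 𝔉 V Ψ :=
  fun s s' hs => (h s s' hs).elim

/-- **Calibration (diagonal)**: if the stub's class is "`s = s'`", `ThetaFunctionPreserved` holds for
every self-equivalence (functors preserve equality of parallel arrows) — the simplest `Ψ`-STABLE class.
[cite: MochizukiEtTh2009, Thm 5.7 p.329–330 (PDF pp.103–104)] -/
theorem thetaFunctionPreserved_of_iff_eq (V : StdThetaPairStub 𝔉)
    (h : ∀ ⦃A B : C⦄ (s s' : A ⟶ B), V.IsStdThetaRootFractionPair s s' ↔ s = s') (Ψ : C ≌ C) :
    ThetaFunctionPreserved 𝔉 V Ψ := by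
  intro A B s s' hs
  rw [h] at hs ⊢
  rw [hs]

/-- Hence the typed Thm. 5.7 predicate is SATISFIABLE at every `𝔉` and every `Ψ` (vacuity calibration:
the statement's content lives in the genuine stub only). [cite: MochizukiEtTh2009, Thm 5.7 p.329–330 (PDF pp.103–104)] -/
theorem exists_thetaFunctionPreserved (Ψ : C ≌ C) :
    ∃ V : StdThetaPairStub 𝔉, ThetaFunctionPreserved 𝔉 V Ψ :=
  ⟨⟨fun _ _ => True⟩, thetaFunctionPreserved_of_forall 𝔉 _ (fun _ _ _ _ => trivial) Ψ⟩

/-- … and with a NON-trivial class as well (the diagonal), so satisfiability is not an artefact of the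
two constant classes. [cite: MochizukiEtTh2009, Thm 5.7 p.329–330 (PDF pp.103–104)] -/
theorem exists_thetaFunctionPreserved_diagonal (Ψ : C ≌ C) :
    ∃ V : StdThetaPairStub 𝔉, (∀ ⦃A B : C⦄ (s s' : A ⟶ B), V.IsStdThetaRootFractionPair s s' ↔ s = s') ∧
      ThetaFunctionPreserved 𝔉 V Ψ :=
  ⟨⟨fun s s' => s = s'⟩, fun _ _ _ _ => Iff.rfl,
    thetaFunctionPreserved_of_iff_eq 𝔉 _ (fun _ _ _ _ => Iff.rfl) Ψ⟩

end FrobenioidCyclotomicRigidity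

end Literature.AnabelianGeometry.EtaleTheta
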